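import Mathlib
import Summits.Ventures.HodgeRepro.Tier4.Common.AdelicDefs
import Summits.Ventures.HodgeRepro.Tier4.Common.AdelicRTF
import Summits.Ventures.HodgeRepro.Tier4.Common.SettingOfData
import Summits.Ventures.HodgeRepro.Tier4.Line1.RTFSetting
import Summits.Ventures.HodgeRepro.Tier4.Line1.PlaneDefs
import Summits.Ventures.HodgeRepro.Tier4.Line1.RationalPoints
import Summits.Ventures.HodgeRepro.Tier4.Line1.CocompactReduction
import Summits.Ventures.HodgeRepro.Tier4.Line1.LocallyCompactGA
import Summits.Ventures.HodgeRepro.Tier4.Line1.SecondCountableGA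
import Summits.Ventures.HodgeRepro.Tier4.Line1.RtfGeometric
import Summits.Ventures.HodgeRepro.Tier4.Line1.RtfSpectral
import Summits.Ventures.HodgeRepro.Tier4.Line1.KernelNondegenerate
import Summits.Ventures.HodgeRepro.Tier4.Line1.IrreducibleSubspace
import Summits.Ventures.HodgeRepro.Tier4.Line1.AdaptedONBGlue
import Summits.Ventures.HodgeRepro.Tier4.Line1.L2InfiniteGA
import Summits.Ventures.HodgeRepro.Tier4.Line1.LinRegular
import Summits.Ventures.HodgeRepro.Tier4.Line1.ThreeLines
import Summits.Ventures.HodgeRepro.Tier4.Line1.IsolatingNbhd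
import Summits.Ventures.HodgeRepro.Tier4.Line1.RationalConj
import Summits.Ventures.HodgeRepro.Tier4.Line1.OrbitalNonzero

/-!
# Tier4/Line1/DefinedContentOfData — the DEFINED half of LINE L1's RTF datum, SORRY-FREE on the tree: J1 + J2 and the
isolation assembly over typer-2's `Setting.ofAdelicData` (the cocompactness data DISPLAYED)

Blind re-derivation cell `pub-hodge-repro`, Tier 4 (README §9–§10), seat t4-L1-p3 (gen 2).  Target tree path
`lean/Summits/Ventures/HodgeRepro/Tier4/Line1/DefinedContentOfData.lean`.  Imports the landed generic layer of
LINE L1 (`RTFSetting`, `RtfGeometric`, `RtfSpectral`, `KernelNondegenerate`, `IrreducibleSubspace`, `AdaptedONBGlue`,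
`IsolatingNbhd`, `OrbitalNonzero`), the instance modules (`RationalPoints`, `CocompactReduction`, `LocallyCompactGA`,
`SecondCountableGA`, `L2InfiniteGA`, `LinRegular`, `ThreeLines`, `RationalConj`) and typer-2's sorry-free
`Common.SettingOfData` (`Setting.ofAdelicData W R μ DG fdG compG compT compT'`).

WHAT THIS IS.  LINE L1's skeleton (v0.31) proves its instance glue — the bridges `isCharacter_ofAdelic` /
`centralMatch_ofAdelic`, J1 `exists_adaptedONB`, J2.b `orbitOf_eq_of_conj`, J2.d′ `exists_isolating_nbhd`, J2
`exists_isolating_tests` and the generic assembly `exists_periods_of_isolation` — over its `Setting.ofAdelic`, whose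
`DG` is `Classical.choose (quotient_compact …)`, the declared wall (I1-c); the skeleton never goes through the gate.
This file is the SAME glue, proof for proof, over typer-2's `Setting.ofAdelicData`, in which the relatively compact
fundamental domain `DG` of `U(W)(k)` in `U(W)(𝔸_k)` is DISPLAYED DATA (`fdG`, `compG`) — so every theorem here is
sorry-free on the tree today, and becomes the skeleton's statement by name the minute (I1-c) is supplied (t4-L1-p5's
`quotient_compact_genuine`, S13199: `DG := Classical.choose (quotient_compact_genuine W hW hg μ)`).  The end product
`exists_defined_content_ofData` is the DEFINED half of the costume's RTF datum (`RTFDatum.Defined` of the skeleton,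
field by field): an adapted orthonormal family complete in `L²(DG)` along irreducible invariant subspaces (J1) and an
isolating pair of test functions with one rational double coset and a non-zero orbital term (J2); and
`exists_periods_ofData` carries it to the output of the relative trace formula — an invariant subspace `τ m`, hit by
`f̄₁`, on which BOTH toric functionals are non-zero.  What is NOT here (the free half, Skeleton L1226): the pins of
these functionals to the face's toric periods, the lift `F1 + F2` and the seesaw components (S1)–(S3).
Nothing here says anything about the status of the Hodge conjecture for CM abelian varieties, which is NOT proved
(HC_CM is NOT proved by anyone in this repository).
-/

set_option autoImplicit false

noncomputable section

namespace Summit.Ventures.HodgeRepro.Tier4.Line1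

open NumberField Common MeasureTheory Topology

/-! ## The generic assembly (Skeleton v0.31 Part I, `J_eq_orbital_of_isolated` / `exists_periods_of_isolation`) -/

namespace RTF

variable {G : Type} [Group G] [TopologicalSpace G] [IsTopologicalGroup G] [MeasurableSpace G]
  [BorelSpace G]

namespace Setting

variable (S : Setting G)

/-- **With a single contributing orbit, `J(f)` is its orbital term** (L1.1 + `orbital_eq_zero_of_not_mem`). -/
theorem J_eq_orbital_of_isolated {χ : S.T → ℂ} {χ' : S.T' → ℂ} (hχ : S.IsCharacter χ)
    (hχ' : S.IsCharacter' χ') {f : G → ℂ} (hf : IsTest f) {o₀ : S.Orbit}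
    (hiso : S.geoSupport f = {o₀}) : S.J χ χ' f = S.orbital χ χ' o₀ f := by
  rw [S.rtf_geometric hχ hχ' hf]
  apply finsum_eq_single
  intro o ho
  apply S.orbital_eq_zero_of_not_mem
  rw [hiso]
  simpa using ho

/-- **THE GENERIC ASSEMBLY**: an adapted orthonormal family, a pair of characters and a pair of test functions whose
convolution is isolated on one orbit with a non-zero orbital term produce an invariant subspace, HIT by `f̄₁`, carrying
BOTH toric functionals (L1.1 + L1.2b + L1.5). -/
theorem exists_periods_of_isolation {χ : S.T → ℂ} {χ' : S.T' → ℂ} (hχ : S.IsCharacter χ)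
    (hχ' : S.IsCharacter' χ') {τ : ℕ → Set (G → ℂ)} {φ : ℕ → G → ℂ} {n : ℕ → ℕ}
    (hB : S.IsAdaptedONB τ φ n) {f₁ f₂ : G → ℂ} (h₁ : IsTest f₁) (h₂ : IsTest f₂)
    (hconv : IsTest (S.conv f₁ f₂)) {o₀ : S.Orbit} (hiso : S.geoSupport (S.conv f₁ f₂) = {o₀})
    (hne : S.orbital χ χ' o₀ (S.conv f₁ f₂) ≠ 0) :
    ∃ m, S.PeriodNonzeroT χ (τ m) ∧ S.PeriodNonzeroT' χ' (τ m) ∧ S.Hit (cj f₁) (τ m) := by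
  have hJ : S.J χ χ' (S.conv f₁ f₂) ≠ 0 := by
    rw [S.J_eq_orbital_of_isolated hχ hχ' hconv hiso]
    exact hne
  obtain ⟨j, hj⟩ := exists_term_ne_zero (S.rtf_spectral hχ hχ' hB h₁ h₂) hJ
  exact ⟨n j, S.atoms hB h₁ h₂ j hj⟩

end Setting

end RTF

/-! ## The instance glue over `Setting.ofAdelicData` (Skeleton v0.31 Part I′, with the cocompactness data displayed) -/

section Instance

variable {k : Type} [Field k] [NumberField k] (W : PlaneData k)

/-- **Linear regularity gives Jacquet regularity** (J2.b-(i)): restrict `IsLinRegular` to unitaries `t ∈ T`, `t′ ∈ T′`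
with `t⁻¹ γ₀ t′ = γ₀`: `t = t′ = x + yΩ` is an `E′_𝔸`-scalar, central by `mem_center_of_mat_eq_scalar`. -/
theorem isRegularRational_of_isLinRegular (γ₀ : rationalPoints W) (h : IsLinRegular W γ₀) :
    IsRegularRational W γ₀ := by
  intro t ht t' ht' hγ
  have hmat : GA.mat W t * GA.mat W (γ₀ : GA W) = GA.mat W (γ₀ : GA W) * GA.mat W t' := by
    have h1 : (γ₀ : GA W) * t' = t * γ₀ := by
      calc (γ₀ : GA W) * t' = t * (t⁻¹ * γ₀ * t') := by group
        _ = t * γ₀ := by rw [hγ]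
    have := congrArg (GA.mat W) h1.symm
    simpa [GA.mat_mul] using this
  have htΩ : GA.mat W t * adMat k W.Ω = adMat k W.Ω * GA.mat W t := ((mem_unitaryGroup W _).mp t.2).1
  have ht'Ω : GA.mat W t' * adMat k W.Ω = adMat k W.Ω * GA.mat W t' := ((mem_unitaryGroup W _).mp t'.2).1
  have htP : ∀ i, GA.mat W t * adMat k (W.P i) = adMat k (W.P i) * GA.mat W t := by
    intro i; fin_cases i
    · exact ht.1
    · exact ht.2
  have ht'Q : ∀ i, GA.mat W t' * adMat k (W.Q i) = adMat k (W.Q i) * GA.mat W t' := by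
    intro i; fin_cases i
    · exact ht'.1
    · exact ht'.2
  obtain ⟨x, y, hx, hx'⟩ := h _ _ htΩ htP ht'Ω ht'Q hmat
  have htt' : t' = t := by
    apply Subtype.ext; apply Units.ext
    show GA.mat W t' = GA.mat W t
    rw [hx, hx']
  subst htt'
  exact ⟨⟨⟨ht, ht'⟩, mem_center_of_mat_eq_scalar W t' hx⟩, rfl⟩

/-- bridge: a test function in the generic sense IS typer-2's `IsTestFn`. -/
theorem isTest_iff_ofData (f : GA W → ℂ) : RTF.IsTest f ↔ Common.IsTestFn W f :=
  ⟨fun h => ⟨h.cont, h.compact⟩, fun h => ⟨h.1, h.2⟩⟩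

variable [MeasurableSpace (GA W)] [BorelSpace (GA W)] (R : RTFData W) (μ : Measure (GA W)) [μ.IsHaarMeasure]
  [R.μT.IsHaarMeasure] [R.μT'.IsHaarMeasure] (DG : Set (GA W))
  (fdG : IsFundamentalDomain (rationalPoints W) DG μ) (compG : IsCompact (closure DG))
  (hT : IsCompact (closure R.DT)) (hT' : IsCompact (closure R.DT'))

/-- bridge: the character `chi` of an `RTFData`, continuous and unitary, is an `IsCharacter` of the data setting. -/
theorem isCharacter_ofAdelicData (hc : Continuous R.chi) (hu : ∀ a, ‖R.chi a‖ = 1) :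
    (Setting.ofAdelicData W R μ DG fdG compG hT hT').IsCharacter R.chi :=
  ⟨hc, R.chi_mul, hu, fun a ha => R.chi_rational a (Subgroup.mem_subgroupOf.mp ha)⟩

/-- bridge: the same for `chi'`. -/
theorem isCharacter'_ofAdelicData (hc : Continuous R.chi') (hu : ∀ a, ‖R.chi' a‖ = 1) :
    (Setting.ofAdelicData W R μ DG fdG compG hT hT').IsCharacter' R.chi' :=
  ⟨hc, R.chi'_mul, hu, fun a ha => R.chi'_rational a (Subgroup.mem_subgroupOf.mp ha)⟩

/-- bridge: N2 of the `RTFData` IS `CentralMatch` on the data setting. -/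
theorem centralMatch_ofAdelicData :
    (Setting.ofAdelicData W R μ DG fdG compG hT hT').CentralMatch R.chi R.chi' :=
  R.chi_centre

/-- **(J1) the discrete spectrum of the compact quotient, on the data setting**: an adapted orthonormal family of
continuous `U(W)(k)`-invariant functions, complete in `L²(DG)`, along IRREDUCIBLE invariant subspaces — from L4-p1's
generic `exists_adaptedONB_of_rungs`, the rung (4b) `exists_irreducible_invariant_subspace_of_nondegenerate ∘
kernelOp_nondegenerate` and p5's `not_finiteDimensional_L2_DG` on the displayed domain. -/
theorem exists_adaptedONB_ofData :
    ∃ (τ : ℕ → Set (GA W → ℂ)) (φ : ℕ → GA W → ℂ) (n : ℕ → ℕ),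
      (Setting.ofAdelicData W R μ DG fdG compG hT hT').IsAdaptedONB τ φ n := by
  haveI := locallyCompact_GA W
  haveI := secondCountable_GA W
  exact (Setting.ofAdelicData W R μ DG fdG compG hT hT').exists_adaptedONB_of_rungs
    (not_finiteDimensional_L2_DG W μ fdG compG)
    (fun V hV hcl hne => (Setting.ofAdelicData W R μ DG fdG compG hT hT').exists_irreducible_invariant_subspace_of_nondegenerate
      V hV hcl hne (Setting.ofAdelicData W R μ DG fdG compG hT hT').kernelOp_nondegenerate)

/-- **(J2.b) two rational points of one adelic `T × T′`-orbit lie in one rational double coset** for `γ₀` linearly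
regular (the Hasse-principle core `exists_rational_conj` through `DoubleCoset.eq`). -/
theorem orbitOf_eq_of_conj_ofData (hW : IsDefinite W) (hg : IsGenuineRow W) (γ γ₀ : rationalPoints W)
    (hreg : IsLinRegular W γ₀) (h : ∃ t ∈ torusT W, ∃ t' ∈ torusT' W, t⁻¹ * γ * t' = γ₀) :
    (Setting.ofAdelicData W R μ DG fdG compG hT hT').orbitOf γ =
      (Setting.ofAdelicData W R μ DG fdG compG hT hT').orbitOf γ₀ := by
  obtain ⟨δ, hδ, δ', hδ', hδk, hδ'k, hconj⟩ := exists_rational_conj W hW hg γ γ₀ hreg h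
  show DoubleCoset.mk _ _ γ = DoubleCoset.mk _ _ γ₀
  rw [DoubleCoset.eq]
  refine ⟨⟨δ⁻¹, (rationalPoints W).inv_mem hδk⟩, ?_, ⟨δ', hδ'k⟩, ?_, ?_⟩
  · show δ⁻¹ ∈ torusT W
    exact (torusT W).inv_mem hδ
  · show δ' ∈ torusT' W
    exact hδ'
  · apply Subtype.ext
    exact hconj.symm

/-- **(J2.d′) an isolating neighbourhood of every linearly regular rational element** (the generic
`exists_isolating_nbhd_of_hasse` + J2.b). -/
theorem exists_isolating_nbhd_ofData (hW : IsDefinite W) (hg : IsGenuineRow W) (γ₀ : rationalPoints W)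
    (hreg : IsLinRegular W γ₀) :
    ∃ U : Set (GA W), IsOpen U ∧ (γ₀ : GA W) ∈ U ∧
      ∀ t ∈ closure R.DT, ∀ t' ∈ closure R.DT', ∀ γ : rationalPoints W,
        (t : GA W)⁻¹ * γ * t' ∈ U →
          (Setting.ofAdelicData W R μ DG fdG compG hT hT').orbitOf γ =
            (Setting.ofAdelicData W R μ DG fdG compG hT hT').orbitOf γ₀ := by
  haveI : T2Space (GA W) := t2Space_GA W
  haveI : LocallyCompactSpace (GA W) := locallyCompact_GA W
  exact (Setting.ofAdelicData W R μ DG fdG compG hT hT').exists_isolating_nbhd_of_hasse γ₀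
    (fun γ h => orbitOf_eq_of_conj_ofData W R μ DG fdG compG hT hT' hW hg γ γ₀ hreg h)

/-- **(J2) isolating test functions exist on the data setting** — for the defined tori and characters (continuous,
unitary, N2) there are test functions `f₁`, `f₂` and ONE rational double coset `o₀` such that `f₁ ⋆ f₂` meets exactly
`o₀` on `DT × DT′` and the orbital term of `o₀` is non-zero (`o₀ = [γ₀]` for the regular `γ₀` of `exists_regular_rational`;
J2.c′ `exists_pair_orbital_ne_zero` inside the isolating neighbourhood of J2.d′). -/
theorem exists_isolating_tests_ofData (hW : IsDefinite W) (hg : IsGenuineRow W) (hc : Continuous R.chi)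
    (hu : ∀ a, ‖R.chi a‖ = 1) (hc' : Continuous R.chi') (hu' : ∀ a, ‖R.chi' a‖ = 1) :
    ∃ (f₁ f₂ : GA W → ℂ) (o₀ : (Setting.ofAdelicData W R μ DG fdG compG hT hT').Orbit),
      RTF.IsTest f₁ ∧ RTF.IsTest f₂ ∧
      RTF.IsTest ((Setting.ofAdelicData W R μ DG fdG compG hT hT').conv f₁ f₂) ∧
      (Setting.ofAdelicData W R μ DG fdG compG hT hT').geoSupport
        ((Setting.ofAdelicData W R μ DG fdG compG hT hT').conv f₁ f₂) = {o₀} ∧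
      (Setting.ofAdelicData W R μ DG fdG compG hT hT').orbital R.chi R.chi' o₀
        ((Setting.ofAdelicData W R μ DG fdG compG hT hT').conv f₁ f₂) ≠ 0 := by
  haveI : Countable (Setting.ofAdelicData W R μ DG fdG compG hT hT').Gk := rationalPoints_countable W
  haveI : T2Space (GA W) := t2Space_GA W
  haveI : LocallyCompactSpace (GA W) := locallyCompact_GA W
  obtain ⟨γ₀, hreg⟩ := exists_regular_rational W hW hg
  have hreg' : IsRegularRational W γ₀ := isRegularRational_of_isLinRegular W γ₀ hreg
  obtain ⟨U, hU, hγU, hiso⟩ := exists_isolating_nbhd_ofData W R μ DG fdG compG hT hT' hW hg γ₀ hreg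
  obtain ⟨f₁, f₂, h₁, h₂, hconv, hsupp, hne⟩ :=
    (Setting.ofAdelicData W R μ DG fdG compG hT hT').exists_pair_orbital_ne_zero
      (isCharacter_ofAdelicData W R μ DG fdG compG hT hT' hc hu)
      (isCharacter'_ofAdelicData W R μ DG fdG compG hT hT' hc' hu')
      (centralMatch_ofAdelicData W R μ DG fdG compG hT hT') γ₀ hreg' hU hγU
  refine ⟨f₁, f₂, (Setting.ofAdelicData W R μ DG fdG compG hT hT').orbitOf γ₀, h₁, h₂, hconv, ?_, hne⟩
  ext o
  constructor
  · rintro ⟨t, ht, t', ht', γ, rfl, hγne⟩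
    exact hiso t (subset_closure ht) t' (subset_closure ht') γ
      (hsupp (subset_tsupport _ (Function.mem_support.mpr hγne)))
  · intro ho
    rw [Set.mem_singleton_iff] at ho
    subst ho
    by_contra h
    exact hne ((Setting.ofAdelicData W R μ DG fdG compG hT hT').orbital_eq_zero_of_not_mem R.chi R.chi' h)

/-- **THE DEFINED HALF OF THE RTF DATUM, on the data setting** (the skeleton's `RTFDatum.Defined`, field by field):
the characters continuous and unitary (hypotheses), an adapted orthonormal family complete in `L²(DG)` (J1) and an
isolating pair of test functions with one rational double coset and a non-zero orbital term (J2). -/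
theorem exists_defined_content_ofData (hW : IsDefinite W) (hg : IsGenuineRow W) (hc : Continuous R.chi)
    (hu : ∀ a, ‖R.chi a‖ = 1) (hc' : Continuous R.chi') (hu' : ∀ a, ‖R.chi' a‖ = 1) :
    ∃ (τ : ℕ → Set (GA W → ℂ)) (φ : ℕ → GA W → ℂ) (n : ℕ → ℕ) (f₁ f₂ : GA W → ℂ)
      (o₀ : (Setting.ofAdelicData W R μ DG fdG compG hT hT').Orbit),
      (Setting.ofAdelicData W R μ DG fdG compG hT hT').IsAdaptedONB τ φ n ∧
      RTF.IsTest f₁ ∧ RTF.IsTest f₂ ∧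
      RTF.IsTest ((Setting.ofAdelicData W R μ DG fdG compG hT hT').conv f₁ f₂) ∧
      (Setting.ofAdelicData W R μ DG fdG compG hT hT').geoSupport
        ((Setting.ofAdelicData W R μ DG fdG compG hT hT').conv f₁ f₂) = {o₀} ∧
      (Setting.ofAdelicData W R μ DG fdG compG hT hT').orbital R.chi R.chi' o₀
        ((Setting.ofAdelicData W R μ DG fdG compG hT hT').conv f₁ f₂) ≠ 0 := by
  obtain ⟨τ, φ, n, hB⟩ := exists_adaptedONB_ofData W R μ DG fdG compG hT hT'
  obtain ⟨f₁, f₂, o₀, h₁, h₂, hconv, hiso, hne⟩ :=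
    exists_isolating_tests_ofData W R μ DG fdG compG hT hT' hW hg hc hu hc' hu'
  exact ⟨τ, φ, n, f₁, f₂, o₀, hB, h₁, h₂, hconv, hiso, hne⟩

/-- **THE OUTPUT OF THE RELATIVE TRACE FORMULA on the data setting**: for a definite genuine plane with continuous
unitary characters satisfying N2, there are an adapted orthonormal family `(τ, φ, n)`, a test function `f₁` and an
index `m` such that the invariant subspace `τ m` is hit by `f̄₁` and carries BOTH toric functionals
(`PeriodNonzeroT χ`, `PeriodNonzeroT' χ′`) — the (P′)-side statement of LINE L1 before the free pins. -/
theorem exists_periods_ofData (hW : IsDefinite W) (hg : IsGenuineRow W) (hc : Continuous R.chi)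
    (hu : ∀ a, ‖R.chi a‖ = 1) (hc' : Continuous R.chi') (hu' : ∀ a, ‖R.chi' a‖ = 1) :
    ∃ (τ : ℕ → Set (GA W → ℂ)) (φ : ℕ → GA W → ℂ) (n : ℕ → ℕ) (f₁ : GA W → ℂ) (m : ℕ),
      (Setting.ofAdelicData W R μ DG fdG compG hT hT').IsAdaptedONB τ φ n ∧ RTF.IsTest f₁ ∧
      (Setting.ofAdelicData W R μ DG fdG compG hT hT').PeriodNonzeroT R.chi (τ m) ∧
      (Setting.ofAdelicData W R μ DG fdG compG hT hT').PeriodNonzeroT' R.chi' (τ m) ∧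
      (Setting.ofAdelicData W R μ DG fdG compG hT hT').Hit (RTF.cj f₁) (τ m) := by
  obtain ⟨τ, φ, n, f₁, f₂, o₀, hB, h₁, h₂, hconv, hiso, hne⟩ :=
    exists_defined_content_ofData W R μ DG fdG compG hT hT' hW hg hc hu hc' hu'
  obtain ⟨m, hm⟩ := (Setting.ofAdelicData W R μ DG fdG compG hT hT').exists_periods_of_isolation
    (isCharacter_ofAdelicData W R μ DG fdG compG hT hT' hc hu)
    (isCharacter'_ofAdelicData W R μ DG fdG compG hT hT' hc' hu') hB h₁ h₂ hconv hiso hne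
  exact ⟨τ, φ, n, f₁, m, hB, h₁, hm.1, hm.2.1, hm.2.2⟩

end Instance

end Summit.Ventures.HodgeRepro.Tier4.Line1

end
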